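import Summits.CriticalPhenomena.PercolationContinuityZ3.Theorems.PercNearOneGluingNoHeavyLowerTailIncStarTwoEdgeBernstein
import Summits.CriticalPhenomena.PercolationContinuityZ3.Theorems.PercNearOneGluingNoHeavyLowerTailIncStarRootEdgeInduction
import HarnessLib

/-!
# The increasing star at a ROOT OF DEGREE TWO: reduction to the root-edge Bernstein forms of `G − s` and three mixed root fibres

Support file for the Sahi programme (`--supports stmt-CriticalPhenomena-4575`, prover prim-sahi-p2 gen 29).  No definitions, no named
facts, no sorries; standard axioms.  Memo `run/shared/lean/prim/prim-sahi/FROM-prim-sahi-p2-gen29-ROOT-FIBRE-DICHOTOMY.md`, `prim-sahi-p2/PROOF-E3.md` §39.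

After THEOREM B⁺ (`IncStarTwoCut.incStar_nonneg_of_twoCut_farStars'`, gen 28) every two-separator of a minimal counterexample to the
increasing star `E₃({s↔b},{s↔c},{s↔y}) ≥ 0` that avoids the root isolates it: the root `s` has exactly two neighbours `u, v`.  By the
two-pair tensor-Bernstein expansion (`EdgeInduction.sahiE3_twoBond`, gen 29) in the weights of `e₁ = s(s,u)`, `e₂ = s(s,v)`, `E₃` is then a
nonnegative combination of sixteen coefficients of the four PINNED laws `P^{ab} = P_{w[e₁↦a][e₂↦b]}`.  Here the elementary ones are
discharged: under `P⁰⁰` the root is almost surely isolated, so the `(0,0)` corner vanishes and the four polarised forms touching it are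
pendant-root forms, nonnegative by Harris' inequality (`real_openConn_pin00`, `polar₁_pin00_left_nonneg`, `polar₁_pin00_right_nonneg`).
**Theorem `incStar_nonneg_of_degTwoRoot`.**  At a root of degree two the increasing star follows from: the stars of the three other
pinned laws (induction hypotheses: fewer fractional pairs), the four root-edge Bernstein forms `polar₁` between `P⁰¹, P¹¹` and between
`P¹⁰, P¹¹` (gen 5's hRZ = REB for the graph `G − s` rooted at `v` with port `u`, and at `u` with port `v`), and the four mixed root
fibres `twoEdgeRF11, RF12, RF21, RF22` (memo §2: `RF11 ≥ 0` by Harris, `RF12, RF21 ≥ 0` by exact certificates in the port/target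
algebra; `RF22` semantically implied, no degree-3 certificate).  Nothing here asserts those facts: they are the hypotheses.
-/

noncomputable section

namespace Summit.CriticalPhenomena.PercolationContinuityZ3.Theorems

namespace IncStar

open MeasureTheory Set Literature.Probability.Percolation Literature.Probability.LatticeModels EdgeInduction
open scoped Classical

variable {n : ℕ}

/-! ### The `(0,0)` corner: a root whose two pairs are pinned closed is almost surely isolated -/

/-- At a root of degree two (`w s(s,z) = 0` unless `z ∈ {u,v}`), under the law with both root pairs pinned CLOSED every hub connection
`{s ↔ t}`, `t ≠ s`, is a null event. [this work] -/
theorem real_openConn_pin00 (w : Sym2 (Fin n) → unitInterval) {s u v : Fin n}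
    (hw : ∀ z : Fin n, z ≠ s → z ≠ u → z ≠ v → w s(s, z) = 0) {t : Fin n} (ht : t ≠ s) (X : Set (BondConfig (Fin n))) :
    (pin₂ w s(s, u) s(s, v) 0 0).real (openConn s t ∩ X) = 0 := by
  set w₀ : Sym2 (Fin n) → unitInterval := Function.update (Function.update w s(s, u) 0) s(s, v) 0 with hw₀
  have hpin : pin₂ w s(s, u) s(s, v) 0 0 = prodBernoulli w₀ := rfl
  rw [hpin]
  -- every non-loop pair at `s` has `w₀`-weight `0`
  have hz : ∀ z : Fin n, z ≠ s → w₀ s(s, z) = 0 := by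
    intro z hzs
    by_cases hzv : z = v
    · subst hzv; simp [hw₀]
    by_cases hzu : z = u
    · subst hzu
      have hne : s(s, z) ≠ s(s, v) := by
        intro h; rw [Sym2.eq_iff] at h
        rcases h with ⟨-, h⟩ | ⟨-, h⟩
        · exact hzv h
        · exact hzs h
      simp [hw₀, Function.update_of_ne hne]
    · have hne1 : s(s, z) ≠ s(s, v) := by
        intro h; rw [Sym2.eq_iff] at h
        rcases h with ⟨-, h⟩ | ⟨-, h⟩
        · exact hzv h
        · exact hzs h
      have hne2 : s(s, z) ≠ s(s, u) := by
        intro h; rw [Sym2.eq_iff] at h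
        rcases h with ⟨-, h⟩ | ⟨-, h⟩
        · exact hzu h
        · exact hzs h
      simp only [hw₀, Function.update_of_ne hne1, Function.update_of_ne hne2]
      exact hw z hzs hzu hzv
  -- hence the weight-`1` component of `s` is `{s}` and it is closed
  set G1 := SimpleGraph.fromEdgeSet {e : Sym2 (Fin n) | w₀ e = 1} with hG1
  have hnotadj : ∀ z : Fin n, ¬ G1.Adj s z := by
    intro z h
    rw [hG1, SimpleGraph.fromEdgeSet_adj] at h
    have h0 := hz z (fun hzs => h.2 hzs.symm)
    have h1 : w₀ s(s, z) = 1 := h.1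
    rw [h0] at h1
    exact zero_ne_one h1
  have hreach : ∀ z : Fin n, G1.Reachable s z → z = s := by
    intro z h
    rw [SimpleGraph.reachable_iff_reflTransGen] at h
    rcases Relation.ReflTransGen.cases_head h with h | ⟨x, hsx, -⟩
    · exact h.symm
    · exact absurd hsx (hnotadj x)
  have hcl : ∀ z x : Fin n, G1.Reachable s z → ¬ G1.Reachable s x → z ≠ x → w₀ s(z, x) = 0 := by
    intro z x hzr hxr _
    have hz' : z = s := hreach z hzr
    rw [hz']
    apply hz x
    intro hxs
    apply hxr
    rw [hxs]
  set G : Set (BondConfig (Fin n)) := {ω | ∀ e, w₀ e = 1 → e ∈ ω} ∩ {ω | ∀ e, w₀ e = 0 → e ∉ ω} with hGdef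
  have hG : (prodBernoulli w₀).real G = 1 := real_sureSet w₀
  have hm : MeasurableSet G := MeasurableSet.of_discrete
  rw [real_eq_real_inter_of_real_eq_one hm hG]
  have hempty : openConn s t ∩ X ∩ G = ∅ := by
    refine Set.subset_empty_iff.1 (fun ω hω => ?_)
    have hst : ω ∈ openConn s t := hω.1.1
    have hG' : ω ∈ ({ω | ∀ e, w₀ e = 1 → e ∈ ω} ∩ {ω | ∀ e, w₀ e = 0 → e ∉ ω} : Set (BondConfig (Fin n))) := hω.2
    have hR := (openConn_iff_sureReachable_of_closed w₀ s hcl hG'.1 hG'.2 t).1 hst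
    exact (ht (hreach t hR)).elim
  rw [hempty, measureReal_empty]

/-- The `(0,0)` corner cubic vanishes at a root of degree two. [this work] -/
theorem sahiE3_pin00 (w : Sym2 (Fin n) → unitInterval) {s u v b c y : Fin n}
    (hw : ∀ z : Fin n, z ≠ s → z ≠ u → z ≠ v → w s(s, z) = 0) (hb : b ≠ s) (hc : c ≠ s) (hy : y ≠ s) :
    sahiE3 (pin₂ w s(s, u) s(s, v) 0 0) (openConn s b) (openConn s c) (openConn s y) = 0 := by
  have e1 : (pin₂ w s(s, u) s(s, v) 0 0).real (openConn s b) = 0 := by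
    simpa using real_openConn_pin00 w hw hb Set.univ
  have e2 : (pin₂ w s(s, u) s(s, v) 0 0).real (openConn s c) = 0 := by
    simpa using real_openConn_pin00 w hw hc Set.univ
  have e3 : (pin₂ w s(s, u) s(s, v) 0 0).real (openConn s y) = 0 := by
    simpa using real_openConn_pin00 w hw hy Set.univ
  have e4 : (pin₂ w s(s, u) s(s, v) 0 0).real (openConn s b ∩ openConn s c ∩ openConn s y) = 0 := by
    rw [Set.inter_assoc]; exact real_openConn_pin00 w hw hb _
  have e5 : (pin₂ w s(s, u) s(s, v) 0 0).real (openConn s b ∩ openConn s c) = 0 := real_openConn_pin00 w hw hb _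
  have e6 : (pin₂ w s(s, u) s(s, v) 0 0).real (openConn s b ∩ openConn s y) = 0 := real_openConn_pin00 w hw hb _
  have e7 : (pin₂ w s(s, u) s(s, v) 0 0).real (openConn s c ∩ openConn s y) = 0 := real_openConn_pin00 w hw hc _
  simp only [sahiE3_def, e1, e2, e3, e4, e5, e6, e7]
  ring

/-- A polarised form whose TWO equal arguments are the `(0,0)` corner is `(2/3)·ν(A∩B∩C) ≥ 0`. [this work] -/
theorem polar₁_pin00_left_nonneg (w : Sym2 (Fin n) → unitInterval) {s u v b c y : Fin n}
    (hw : ∀ z : Fin n, z ≠ s → z ≠ u → z ≠ v → w s(s, z) = 0) (hb : b ≠ s) (hc : c ≠ s) (hy : y ≠ s)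
    (ν : Measure (BondConfig (Fin n))) :
    0 ≤ polar₁ (pin₂ w s(s, u) s(s, v) 0 0) ν (openConn s b) (openConn s c) (openConn s y) := by
  have e1 : (pin₂ w s(s, u) s(s, v) 0 0).real (openConn s b) = 0 := by
    simpa using real_openConn_pin00 w hw hb Set.univ
  have e2 : (pin₂ w s(s, u) s(s, v) 0 0).real (openConn s c) = 0 := by
    simpa using real_openConn_pin00 w hw hc Set.univ
  have e3 : (pin₂ w s(s, u) s(s, v) 0 0).real (openConn s y) = 0 := by
    simpa using real_openConn_pin00 w hw hy Set.univ
  have e4 : (pin₂ w s(s, u) s(s, v) 0 0).real (openConn s b ∩ openConn s c ∩ openConn s y) = 0 := by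
    rw [Set.inter_assoc]; exact real_openConn_pin00 w hw hb _
  have e5 : (pin₂ w s(s, u) s(s, v) 0 0).real (openConn s b ∩ openConn s c) = 0 := real_openConn_pin00 w hw hb _
  have e6 : (pin₂ w s(s, u) s(s, v) 0 0).real (openConn s b ∩ openConn s y) = 0 := real_openConn_pin00 w hw hb _
  have e7 : (pin₂ w s(s, u) s(s, v) 0 0).real (openConn s c ∩ openConn s y) = 0 := real_openConn_pin00 w hw hc _
  simp only [polar₁, e1, e2, e3, e4, e5, e6, e7]
  have h0 : 0 ≤ ν.real (openConn s b ∩ openConn s c ∩ openConn s y) := measureReal_nonneg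
  nlinarith [h0]

/-- A polarised form whose SINGLE argument is the `(0,0)` corner is a pendant-root form of the other (product) law:
`(1/3)(4μ(ABC) − Σ μ(A)μ(B∩C)) ≥ 0` by Harris' inequality. [this work] -/
theorem polar₁_pin00_right_nonneg (w w' : Sym2 (Fin n) → unitInterval) {s u v b c y : Fin n}
    (hw : ∀ z : Fin n, z ≠ s → z ≠ u → z ≠ v → w s(s, z) = 0) (hb : b ≠ s) (hc : c ≠ s) (hy : y ≠ s) :
    0 ≤ polar₁ (prodBernoulli w') (pin₂ w s(s, u) s(s, v) 0 0) (openConn s b) (openConn s c) (openConn s y) := by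
  have e1 : (pin₂ w s(s, u) s(s, v) 0 0).real (openConn s b) = 0 := by
    simpa using real_openConn_pin00 w hw hb Set.univ
  have e2 : (pin₂ w s(s, u) s(s, v) 0 0).real (openConn s c) = 0 := by
    simpa using real_openConn_pin00 w hw hc Set.univ
  have e3 : (pin₂ w s(s, u) s(s, v) 0 0).real (openConn s y) = 0 := by
    simpa using real_openConn_pin00 w hw hy Set.univ
  have e4 : (pin₂ w s(s, u) s(s, v) 0 0).real (openConn s b ∩ openConn s c ∩ openConn s y) = 0 := by
    rw [Set.inter_assoc]; exact real_openConn_pin00 w hw hb _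
  have e5 : (pin₂ w s(s, u) s(s, v) 0 0).real (openConn s b ∩ openConn s c) = 0 := real_openConn_pin00 w hw hb _
  have e6 : (pin₂ w s(s, u) s(s, v) 0 0).real (openConn s b ∩ openConn s y) = 0 := real_openConn_pin00 w hw hb _
  have e7 : (pin₂ w s(s, u) s(s, v) 0 0).real (openConn s c ∩ openConn s y) = 0 := real_openConn_pin00 w hw hc _
  simp only [polar₁, e1, e2, e3, e4, e5, e6, e7]
  -- Harris under the product law `prodBernoulli w'`: μ(A)μ(B∩C) ≤ μ(A∩B∩C) etc.
  have hm : ∀ X : Set (BondConfig (Fin n)), MeasurableSet X := fun _ => MeasurableSet.of_discrete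
  have hA := isUpperSet_openConn s b
  have hB := isUpperSet_openConn s c
  have hC := isUpperSet_openConn s y
  have k1 := prodBernoulli_harris w' hA (hB.inter hC) (hm _) (hm _)
  have k2 := prodBernoulli_harris w' hB (hA.inter hC) (hm _) (hm _)
  have k3 := prodBernoulli_harris w' hC (hA.inter hB) (hm _) (hm _)
  have r1 : openConn s b ∩ (openConn s c ∩ openConn s y) = openConn s b ∩ openConn s c ∩ openConn s y := by
    rw [Set.inter_assoc]
  have r2 : openConn s c ∩ (openConn s b ∩ openConn s y) = openConn s b ∩ openConn s c ∩ openConn s y := by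
    ext ω; simp only [Set.mem_inter_iff]; tauto
  have r3 : openConn s y ∩ (openConn s b ∩ openConn s c) = openConn s b ∩ openConn s c ∩ openConn s y := by
    ext ω; simp only [Set.mem_inter_iff]; tauto
  rw [r1] at k1
  rw [r2] at k2
  rw [r3] at k3
  have h0 : 0 ≤ (prodBernoulli w').real (openConn s b ∩ openConn s c ∩ openConn s y) := measureReal_nonneg
  nlinarith [k1, k2, k3, h0]

/-! ### The reduction theorem -/

/-- **THE INCREASING STAR AT A ROOT OF DEGREE TWO.**  Let the root `s` have positive weight only towards `u ≠ v`, `u ≠ s` (and the targets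
`b, c, y` differ from `s`).  With `P^{ab} = P_{w[s(s,u)↦a][s(s,v)↦b]}`: if the stars of `P⁰¹, P¹⁰, P¹¹` are nonnegative (induction
hypotheses), the four root-edge Bernstein forms `polar₁ P⁰¹ P¹¹`, `polar₁ P¹¹ P⁰¹`, `polar₁ P¹⁰ P¹¹`, `polar₁ P¹¹ P¹⁰` are nonnegative
(hRZ for `G − s` rooted at `v` with port `u`, resp. at `u` with port `v`), and the four mixed root fibres `twoEdgeRF11/12/21/22` are
nonnegative, then `E₃({s↔b},{s↔c},{s↔y}) ≥ 0` under `prodBernoulli w`. [this work] -/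
theorem incStar_nonneg_of_degTwoRoot (w : Sym2 (Fin n) → unitInterval) {s u v b c y : Fin n}
    (hus : u ≠ s) (huv : u ≠ v) (hb : b ≠ s) (hc : c ≠ s) (hy : y ≠ s)
    (hw : ∀ z : Fin n, z ≠ s → z ≠ u → z ≠ v → w s(s, z) = 0)
    (h03 : 0 ≤ sahiE3 (pin₂ w s(s, u) s(s, v) 0 1) (openConn s b) (openConn s c) (openConn s y))
    (h30 : 0 ≤ sahiE3 (pin₂ w s(s, u) s(s, v) 1 0) (openConn s b) (openConn s c) (openConn s y))
    (h33 : 0 ≤ sahiE3 (pin₂ w s(s, u) s(s, v) 1 1) (openConn s b) (openConn s c) (openConn s y))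
    (h13 : 0 ≤ polar₁ (pin₂ w s(s, u) s(s, v) 0 1) (pin₂ w s(s, u) s(s, v) 1 1) (openConn s b) (openConn s c) (openConn s y))
    (h23 : 0 ≤ polar₁ (pin₂ w s(s, u) s(s, v) 1 1) (pin₂ w s(s, u) s(s, v) 0 1) (openConn s b) (openConn s c) (openConn s y))
    (h31 : 0 ≤ polar₁ (pin₂ w s(s, u) s(s, v) 1 0) (pin₂ w s(s, u) s(s, v) 1 1) (openConn s b) (openConn s c) (openConn s y))
    (h32 : 0 ≤ polar₁ (pin₂ w s(s, u) s(s, v) 1 1) (pin₂ w s(s, u) s(s, v) 1 0) (openConn s b) (openConn s c) (openConn s y))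
    (h11 : 0 ≤ twoEdgeRF11 w s(s, u) s(s, v) (openConn s b) (openConn s c) (openConn s y))
    (h12 : 0 ≤ twoEdgeRF12 w s(s, u) s(s, v) (openConn s b) (openConn s c) (openConn s y))
    (h21 : 0 ≤ twoEdgeRF21 w s(s, u) s(s, v) (openConn s b) (openConn s c) (openConn s y))
    (h22 : 0 ≤ twoEdgeRF22 w s(s, u) s(s, v) (openConn s b) (openConn s c) (openConn s y)) :
    0 ≤ sahiE3 (prodBernoulli w) (openConn s b) (openConn s c) (openConn s y) := by
  have hne : s(s, u) ≠ s(s, v) := by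
    intro h; rw [Sym2.eq_iff] at h
    rcases h with ⟨-, h⟩ | ⟨-, h⟩
    · exact huv h
    · exact hus h
  have h00 : 0 ≤ sahiE3 (pin₂ w s(s, u) s(s, v) 0 0) (openConn s b) (openConn s c) (openConn s y) :=
    (sahiE3_pin00 w hw hb hc hy).symm.le
  have h01 := polar₁_pin00_left_nonneg w hw hb hc hy (pin₂ w s(s, u) s(s, v) 0 1)
  have h10 := polar₁_pin00_left_nonneg w hw hb hc hy (pin₂ w s(s, u) s(s, v) 1 0)
  have h02 : 0 ≤ polar₁ (pin₂ w s(s, u) s(s, v) 0 1) (pin₂ w s(s, u) s(s, v) 0 0)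
      (openConn s b) (openConn s c) (openConn s y) :=
    polar₁_pin00_right_nonneg w _ hw hb hc hy
  have h20 : 0 ≤ polar₁ (pin₂ w s(s, u) s(s, v) 1 0) (pin₂ w s(s, u) s(s, v) 0 0)
      (openConn s b) (openConn s c) (openConn s y) :=
    polar₁_pin00_right_nonneg w _ hw hb hc hy
  exact sahiE3_nonneg_of_twoBond w hne _ _ _ h00 h03 h30 h33 h01 h02 h10 h20 h13 h23 h31 h32 h11 h12 h21 h22

end IncStar

end Summit.CriticalPhenomena.PercolationContinuityZ3.Theorems

end
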